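import Summits.BirchSwinnertonDyer.BirchSwinnertonDyer.Theorems.KatoDescentPotSupersingularWildUpperUnitTwistRecordsClassO608
import Summits.BirchSwinnertonDyer.BirchSwinnertonDyer.Theorems.KatoDescentPotSupersingularWildUpperUnitTwistRecordsClassO609
import Summits.BirchSwinnertonDyer.BirchSwinnertonDyer.Theorems.KatoDescentPotSupersingularWildUpperUnitTwistRecordsFlat21
import Summits.BirchSwinnertonDyer.BirchSwinnertonDyer.Theorems.KatoDescentPotSupersingularWildUpperUnitTwistRecordsFlat23
import Summits.BirchSwinnertonDyer.BirchSwinnertonDyer.Theorems.KatoDescentPotSupersingularWildUpperUnitTwistRecordsFlat61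
import Summits.BirchSwinnertonDyer.BirchSwinnertonDyer.Theorems.KatoDescentPotSupersingularWildUpperUnitTwistRecordsSharp13
import Summits.BirchSwinnertonDyer.BirchSwinnertonDyer.Theorems.KatoDescentPotSupersingularWildUpperUnitTwistRecordsSharp38
import Summits.BirchSwinnertonDyer.BirchSwinnertonDyer.Theorems.KatoDescentPotSupersingularWildFineSelmerLayerOneL5Door
import HarnessLib

/-!
# Route `KatoDescentPotSupersingular` (rung K9, sub-rung B5 = O6 wild `p = 3`, cell `bsd-potss`): per-row records on the FACT-FREE door L5 at LAYER 1
# — statement (A) of Coates–Sujatha at `(E, 3)` with NO named fact, and U₀ modulo `hKatoA hGZK hmod`, for K9 U₀-ns rows with `E(ℚ₃)[3] ≠ 0` (door L6 and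
# Deo–Ray–Sujatha's printed criterion void at every layer), part 07 of 12: 209088fk1, 228150bz1, 228150hh1, 228150hw1, 228150s1
# (seat `bsd-potss-k9-c4` g25; road = this seat's door file `…WildFineSelmerLayerOneL5Door` over conjA-anchor g18's kernel door L5
# `CoatesSujatha2005.conjA_of_homTrivial_layer'` (p699505) + arithmetic (c3′) (p700300); `--supports stmt-BirchSwinnertonDyer-19197 --as helper`)

HONEST FRAMING. THEOREMS ONLY (no definition, no named fact, no `sorry`); PER ROW — NOT a class theorem; nothing is booked; items 19189 / 19197 /
19942 / 19386 stay OPEN at class level (class-wide open input of record: the zeta crux 24327); Conjecture A and BSD are proved for NO class of curves.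
ROAD (door L5 of conjA-anchor g15 §2, KERNEL since g18 2026-08-29, layer `n + 1 = 1`, `L₁ = ℚ(E[3])·ℚ₁ = W.divisionField 3 ⊔ κ.layer 1`, `ℚ₁ = ℚ(ζ₉)⁺`):
`E[3]` irreducible (kernel `irr_g…_3`) and `Δ(E)` a CUBE (kernel `Δ_cube_g…` here / `Δ_eq_cube_g…` imported ⟹ `3 ∤ #Gal(ℚ(E[3])/ℚ)`, (c1)); per bad prime
`q ≠ 3`: (c3′)₁ «`q` inert in `ℚ₁`» for `q ≢ ±1 (mod 9)` — KERNEL (`decide`, door lemma `not_decomp_le_layerSubgroup_one`) —, else (c3) «`E(ℚ_q)[3] = 0`»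
DISPLAYED in the `E[3]`-currency (`hc3_q`: no non-zero point of `E[3]` is fixed by the decomposition group at `q`; numerically `#E(ℚ_q)[3] = 1`, the `q:1`
entry of the kit I-line `badloc`); and ONE displayed class-group datum of `L₁` quantified over every cyclotomic `κ` (they share `ℚ₁`), in the shape the row
needs: (S) `hS` «every additive `Cl(𝓞_{L₁}) → E[3]` killing the classes above `3` and the bad primes is `0`» (= the `3`-part of `Cl(L₁)/⟨S-classes⟩` is
trivial: kit `r3S = 0`), (C) `hh1` «`3 ∤ h(L₁)`» (no bad-prime data), or (E) `hL5` = (c2)_{S,1} verbatim («every `Γ_ℚ`-EQUIVARIANT additive … is `0`»: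
kit `r3S > 0` but `E[3]` absent from the `S`-split class group, covariant convention of `drsl1.gp`, convention certificate kit j313432) ⟹ (A) at `(E,3)`
for every cyclotomic `ℤ₃`-extension — NO NAMED FACT (`conjA_g…_3_L5`); and U₀ `MissingUpperBoundAt E 3` modulo `hKatoA hGZK hmod` + Cremona's
`r_an = 0` (`missingUpperBoundAt_g…_3_L5`).  NOTHING is assumed at `3`: these rows have `#E(ℚ₃)[3] = 3` (kit j265757 / j313803 / j314664 / j314667
I-lines), so door L6 (`…ClassNumberL6Records`) and the Deo–Ray–Sujatha records cannot serve them; their earlier U₀/(A) records all display a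
`μ`-input, Ferrero–Washington, a Fukuda fact or an anchor.  NUMERICS (conjA-anchor g15, PARI/GP 2.17, engines `drsl1.gp` 83fb2bf749aa288c /
`l5layer1p.gp`; class groups of the degree-24 (`3Ns`) / degree-48 (`3Nn`) field `L₁` under GRH — `bnfcertify` of a degree-24 `L₁` did not finish in
1 h 50, kit j313888): per row `h(L₁)`, its cyclic structure, the `3`-rank `r3S` of `Cl(L₁)/⟨classes of the primes above 3 and the bad primes⟩` and the
number of such primes are quoted in the section header.  KERNEL lemmas `isElliptic_g…`, `isGloballyMinimal_g…`, `irr_g…_3`, `classO6_g…_3`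
(and `Δ_eq_cube_g…` for the residue rows) are IMPORTED (k9-c4 g16–g18 / k8t-c4 g15 files, namespace `…Theorems.WildUpperUnitTwistRecords`).

References: [CoatesSujatha2005] Thm. 3.4, Lemma 3.8; [DeoRaySujatha2023] Thm. 3.8 (c1)(c2)(c3) (arXiv:2202.09937 p. 9); [LimSujatha2018] §3;
[Washington1997] §13.1; [Marcus2018] Ch. 4 Ex. 12(a); [Serre1972] §2.4 Prop. 15, §5.3; [Kato2004Asterisque] Thm. 14.5 (3), Prop. 14.16 (2); [Cremona2006] Table 1.
-/

set_option autoImplicit false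
set_option linter.dupNamespace false

noncomputable section

open scoped Classical NumberField nonZeroDivisors
open WeierstrassCurve NumberField Field IsDedekindDomain IntermediateField
  Literature.NumberTheory.EllipticCurves Literature.NumberTheory.EllipticCurves.Rank1Residual
  Literature.NumberTheory.EllipticCurves.Rank1Residual.Typed
  Literature.NumberTheory.GaloisRepresentations Literature.NumberTheory.NumberFields
  Literature.NumberTheory.SerreUniformity Literature.NumberTheory.IwasawaTheory
  Summit.BirchSwinnertonDyer.Rank1Residual Summit.BirchSwinnertonDyer.Rank1Residual.Additive
  Summit.BirchSwinnertonDyer.BirchSwinnertonDyer.Theorems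
  Summit.BirchSwinnertonDyer.BirchSwinnertonDyer.Theorems.WildUpperUnitTwistRecords

namespace Summit.BirchSwinnertonDyer.BirchSwinnertonDyer.Theorems.WildFineSelmerLayerOneL5Records

/-! ### `209088fk1` @ `p = 3` — `N = 209088`; Cremona: `r_an = 0`; O6 wild at `3`; image `3Ns`; `ℚ(E[3])` of degree 8 (`h = 2`); `#E(ℚ₃)[3] = 3`;
bad places `2:1;11:1` (`q:#E(ℚ_q)[3]`); LAYER 1 (kit j314664, GRH): `L₁` of degree 24, `h(L₁) = 6` `[6]`, 7 primes of `L₁` above `3` and the bad primes,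
`3`-rank of `Cl(L₁)/⟨their classes⟩` = 0. Shape (S). First (A)/U₀ record for this row free of `μ`-inputs, Fukuda facts and anchors. -/

/-- `Δ(209088fk1) = ((-4224))³` — a CUBE (kernel, `norm_num`). [cite: Serre1972, §5.3] [cite: Cremona2006, Table 1 (Cremona label 209088fk1)] -/
theorem Δ_cube_g209088fk1 : (⟨0, 0, 0, (-396), 13552⟩ : WeierstrassCurve ℚ).Δ = (((-4224) : ℚ)) ^ 3 := by
  norm_num [WeierstrassCurve.Δ, WeierstrassCurve.b₂, WeierstrassCurve.b₄, WeierstrassCurve.b₆, WeierstrassCurve.b₈]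

/-- **(A) AT `(209088fk1, 3)` — NO NAMED FACT.**  Statement (A) of Coates–Sujatha for THIS curve at `p = 3` (the dual fine Selmer group over `ℚ_cyc` is
finitely generated over `ℤ₃`, every cyclotomic `ℤ₃`-extension), by door L5 at layer 1, shape (S): KERNEL `irr_g209088fk1_3`, `Δ_cube_g209088fk1` ; (c3′)₁ by `decide`;
DISPLAYED `hS` (the S-classes generate `Cl(L₁) ⊗ 𝔽₃`, kit j314664 `r3S = 0`); (c3′)₁ KERNEL at `2`, `11` (`q² % 9 ≠ 1`, `decide`). Per row; nothing booked; (A)/BSD proved for no class.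
[cite: CoatesSujatha2005, §3 Thm. 3.4 and Lemma 3.8] [cite: DeoRaySujatha2023, §3 Thm. 3.8 (c1), (c2), (c3) (arXiv:2202.09937 p. 9)]
[cite: Serre1972, §2.4 Prop. 15, §5.3] [cite: Cremona2006, Table 1 (Cremona label 209088fk1)] -/
theorem conjA_g209088fk1_3_L5
    {W : WeierstrassCurve ℚ} [W.IsElliptic] (hWeq : W = (⟨0, 0, 0, (-396), 13552⟩ : WeierstrassCurve ℚ))
    (hS : ∀ κ : ZpExtension ℚ 3, κ.IsCyclotomic →
      haveI := κ.isGalois_layer_holds (0 + 1)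
      haveI := κ.finiteDimensional_layer_holds (0 + 1)
      haveI : NumberField ↥(W.divisionField 3 ⊔ κ.layer (0 + 1)) := NumberField.of_module_finite ℚ _
      ∀ (f : Additive (ClassGroup (𝓞 ↥(W.divisionField 3 ⊔ κ.layer (0 + 1)))) →+ geomTorsion W ((3 : ℕ) : ℤ)),
      (∀ (w : HeightOneSpectrum (𝓞 ↥(W.divisionField 3 ⊔ κ.layer (0 + 1)))) (u : HeightOneSpectrum (𝓞 ℚ)),
          (((3 : ℕ) : 𝓞 ℚ) ∈ u.asIdeal ∨ (((2 : ℕ) : 𝓞 ℚ) ∈ u.asIdeal ∨ ((11 : ℕ) : 𝓞 ℚ) ∈ u.asIdeal)) → w.asIdeal.under (𝓞 ℚ) = u.asIdeal →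
        f (Additive.ofMul (ClassGroup.mk0 ⟨w.asIdeal, mem_nonZeroDivisors_of_ne_zero w.ne_bot⟩)) = 0) →
      f = 0)
    (κ : ZpExtension ℚ 3) (hκ : κ.IsCyclotomic) :
    ∃ (γ : absoluteGaloisGroup ℚ) (Df : W.FineSelmerDualData κ γ),
      Module.Finite ℤ_[3] (RestrictScalars ℤ_[3] (IwasawaAlgebra 3) Df.X) := by
  subst hWeq
  exact WildFineSelmerLayerOneL5Door.conjA_three_layer_one_of_Δ_eq_cube_of_sClasses _ irr_g209088fk1_3 Δ_cube_g209088fk1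
    (fun u => ((2 : ℕ) : 𝓞 ℚ) ∈ u.asIdeal ∨ ((11 : ℕ) : 𝓞 ℚ) ∈ u.asIdeal)
    (fun κ' hκ' u hu => by
      rcases hu with h | h
      · exact Or.inl (WildFineSelmerLayerOneL5Door.not_decomp_le_layerSubgroup_one hκ' (by norm_num) h (by decide) (by decide))
      · exact Or.inl (WildFineSelmerLayerOneL5Door.not_decomp_le_layerSubgroup_one hκ' (by norm_num) h (by decide) (by decide)))
    hS κ hκ

/-- **RECORD — U₀ `ord₃ #Ш(E) ≤ ord₃ #Ш(E)_an` for `E = 209088fk1` at `p = 3` on the fact-free door L5 (layer 1, shape (S))** (U₀-ns row of K9 items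
19189 / 19197): KERNEL `classO6_g209088fk1_3`, `irr_g209088fk1_3`, `Δ_cube_g209088fk1`; DISPLAYED named facts `hKatoA hGZK hmod` ONLY, Cremona's `r_an = 0` (`hr`), and
`hS` (the S-classes generate `Cl(L₁) ⊗ 𝔽₃`, kit j314664 `r3S = 0`); (c3′)₁ KERNEL at `2`, `11` (`q² % 9 ≠ 1`, `decide`). Per row; nothing booked; BSD is not proved by this.
[cite: Kato2004Asterisque, Thm. 14.5 (3) (p. 236) and Prop. 14.16 (2)] [cite: CoatesSujatha2005, §3 Thm. 3.4]
[cite: DeoRaySujatha2023, §3 Thm. 3.8] [cite: Cremona2006, Table 1 (Cremona label 209088fk1)] -/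
theorem missingUpperBoundAt_g209088fk1_3_L5
    (hKatoA : Kato2004.rankZero_padicValNat_sha_add_padicValNat_tamagawa_le_of_additive_potGood_of_irreducible_of_fineSelmerDual_fg)
    (hGZK : rank_eq_analyticRank_of_analyticRank_le_one) (hmod : hasEntireLFunction_rat)
    {W : WeierstrassCurve ℚ} [W.IsElliptic] [W.IsGloballyMinimal] (hWeq : W = (⟨0, 0, 0, (-396), 13552⟩ : WeierstrassCurve ℚ)) (hr : W.analyticRank = 0)
    (hS : ∀ κ : ZpExtension ℚ 3, κ.IsCyclotomic →
      haveI := κ.isGalois_layer_holds (0 + 1)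
      haveI := κ.finiteDimensional_layer_holds (0 + 1)
      haveI : NumberField ↥(W.divisionField 3 ⊔ κ.layer (0 + 1)) := NumberField.of_module_finite ℚ _
      ∀ (f : Additive (ClassGroup (𝓞 ↥(W.divisionField 3 ⊔ κ.layer (0 + 1)))) →+ geomTorsion W ((3 : ℕ) : ℤ)),
      (∀ (w : HeightOneSpectrum (𝓞 ↥(W.divisionField 3 ⊔ κ.layer (0 + 1)))) (u : HeightOneSpectrum (𝓞 ℚ)),
          (((3 : ℕ) : 𝓞 ℚ) ∈ u.asIdeal ∨ (((2 : ℕ) : 𝓞 ℚ) ∈ u.asIdeal ∨ ((11 : ℕ) : 𝓞 ℚ) ∈ u.asIdeal)) → w.asIdeal.under (𝓞 ℚ) = u.asIdeal →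
        f (Additive.ofMul (ClassGroup.mk0 ⟨w.asIdeal, mem_nonZeroDivisors_of_ne_zero w.ne_bot⟩)) = 0) →
      f = 0) :
    MissingUpperBoundAt W 3 := by
  subst hWeq
  haveI : Fact (Nat.Prime 3) := ⟨Nat.prime_three⟩
  exact WildFineSelmerSupersingularCMAnchor.missingUpperBoundAt_wild_of_conjA hKatoA hGZK hmod _ hr classO6_g209088fk1_3 irr_g209088fk1_3
    (fun κ hκ => conjA_g209088fk1_3_L5 rfl hS κ hκ)

/-! ### `228150bz1` @ `p = 3` — `N = 228150`; Cremona: `r_an = 0`; O6 wild at `3`; image `3Ns`; `ℚ(E[3])` of degree 8 (`h = 8`); `#E(ℚ₃)[3] = 3`;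
bad places `2:3;5:1;13:1` (`q:#E(ℚ_q)[3]`); LAYER 1 (kit j314664, GRH): `L₁` of degree 24, `h(L₁) = 72` `[12, 6]`, 12 primes of `L₁` above `3` and the bad primes,
`3`-rank of `Cl(L₁)/⟨their classes⟩` = 0. Shape (S). First (A)/U₀ record for this row free of `μ`-inputs, Fukuda facts and anchors. -/

/-- `Δ(228150bz1) = (1318200)³` — a CUBE (kernel, `norm_num`). [cite: Serre1972, §5.3] [cite: Cremona2006, Table 1 (Cremona label 228150bz1)] -/
theorem Δ_cube_g228150bz1 : (⟨1, (-1), 1, (-463430), 97290197⟩ : WeierstrassCurve ℚ).Δ = ((1318200 : ℚ)) ^ 3 := by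
  norm_num [WeierstrassCurve.Δ, WeierstrassCurve.b₂, WeierstrassCurve.b₄, WeierstrassCurve.b₆, WeierstrassCurve.b₈]

/-- **(A) AT `(228150bz1, 3)` — NO NAMED FACT.**  Statement (A) of Coates–Sujatha for THIS curve at `p = 3` (the dual fine Selmer group over `ℚ_cyc` is
finitely generated over `ℤ₃`, every cyclotomic `ℤ₃`-extension), by door L5 at layer 1, shape (S): KERNEL `irr_g228150bz1_3`, `Δ_cube_g228150bz1` ; (c3′)₁ by `decide`;
DISPLAYED `hS` (the S-classes generate `Cl(L₁) ⊗ 𝔽₃`, kit j314664 `r3S = 0`); (c3′)₁ KERNEL at `2`, `5`, `13` (`q² % 9 ≠ 1`, `decide`). Per row; nothing booked; (A)/BSD proved for no class.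
[cite: CoatesSujatha2005, §3 Thm. 3.4 and Lemma 3.8] [cite: DeoRaySujatha2023, §3 Thm. 3.8 (c1), (c2), (c3) (arXiv:2202.09937 p. 9)]
[cite: Serre1972, §2.4 Prop. 15, §5.3] [cite: Cremona2006, Table 1 (Cremona label 228150bz1)] -/
theorem conjA_g228150bz1_3_L5
    {W : WeierstrassCurve ℚ} [W.IsElliptic] (hWeq : W = (⟨1, (-1), 1, (-463430), 97290197⟩ : WeierstrassCurve ℚ))
    (hS : ∀ κ : ZpExtension ℚ 3, κ.IsCyclotomic →
      haveI := κ.isGalois_layer_holds (0 + 1)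
      haveI := κ.finiteDimensional_layer_holds (0 + 1)
      haveI : NumberField ↥(W.divisionField 3 ⊔ κ.layer (0 + 1)) := NumberField.of_module_finite ℚ _
      ∀ (f : Additive (ClassGroup (𝓞 ↥(W.divisionField 3 ⊔ κ.layer (0 + 1)))) →+ geomTorsion W ((3 : ℕ) : ℤ)),
      (∀ (w : HeightOneSpectrum (𝓞 ↥(W.divisionField 3 ⊔ κ.layer (0 + 1)))) (u : HeightOneSpectrum (𝓞 ℚ)),
          (((3 : ℕ) : 𝓞 ℚ) ∈ u.asIdeal ∨ (((2 : ℕ) : 𝓞 ℚ) ∈ u.asIdeal ∨ (((5 : ℕ) : 𝓞 ℚ) ∈ u.asIdeal ∨ ((13 : ℕ) : 𝓞 ℚ) ∈ u.asIdeal))) → w.asIdeal.under (𝓞 ℚ) = u.asIdeal →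
        f (Additive.ofMul (ClassGroup.mk0 ⟨w.asIdeal, mem_nonZeroDivisors_of_ne_zero w.ne_bot⟩)) = 0) →
      f = 0)
    (κ : ZpExtension ℚ 3) (hκ : κ.IsCyclotomic) :
    ∃ (γ : absoluteGaloisGroup ℚ) (Df : W.FineSelmerDualData κ γ),
      Module.Finite ℤ_[3] (RestrictScalars ℤ_[3] (IwasawaAlgebra 3) Df.X) := by
  subst hWeq
  exact WildFineSelmerLayerOneL5Door.conjA_three_layer_one_of_Δ_eq_cube_of_sClasses _ irr_g228150bz1_3 Δ_cube_g228150bz1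
    (fun u => ((2 : ℕ) : 𝓞 ℚ) ∈ u.asIdeal ∨ (((5 : ℕ) : 𝓞 ℚ) ∈ u.asIdeal ∨ ((13 : ℕ) : 𝓞 ℚ) ∈ u.asIdeal))
    (fun κ' hκ' u hu => by
      rcases hu with h | h | h
      · exact Or.inl (WildFineSelmerLayerOneL5Door.not_decomp_le_layerSubgroup_one hκ' (by norm_num) h (by decide) (by decide))
      · exact Or.inl (WildFineSelmerLayerOneL5Door.not_decomp_le_layerSubgroup_one hκ' (by norm_num) h (by decide) (by decide))
      · exact Or.inl (WildFineSelmerLayerOneL5Door.not_decomp_le_layerSubgroup_one hκ' (by norm_num) h (by decide) (by decide)))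
    hS κ hκ

/-- **RECORD — U₀ `ord₃ #Ш(E) ≤ ord₃ #Ш(E)_an` for `E = 228150bz1` at `p = 3` on the fact-free door L5 (layer 1, shape (S))** (U₀-ns row of K9 items
19189 / 19197): KERNEL `classO6_g228150bz1_3`, `irr_g228150bz1_3`, `Δ_cube_g228150bz1`; DISPLAYED named facts `hKatoA hGZK hmod` ONLY, Cremona's `r_an = 0` (`hr`), and
`hS` (the S-classes generate `Cl(L₁) ⊗ 𝔽₃`, kit j314664 `r3S = 0`); (c3′)₁ KERNEL at `2`, `5`, `13` (`q² % 9 ≠ 1`, `decide`). Per row; nothing booked; BSD is not proved by this.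
[cite: Kato2004Asterisque, Thm. 14.5 (3) (p. 236) and Prop. 14.16 (2)] [cite: CoatesSujatha2005, §3 Thm. 3.4]
[cite: DeoRaySujatha2023, §3 Thm. 3.8] [cite: Cremona2006, Table 1 (Cremona label 228150bz1)] -/
theorem missingUpperBoundAt_g228150bz1_3_L5
    (hKatoA : Kato2004.rankZero_padicValNat_sha_add_padicValNat_tamagawa_le_of_additive_potGood_of_irreducible_of_fineSelmerDual_fg)
    (hGZK : rank_eq_analyticRank_of_analyticRank_le_one) (hmod : hasEntireLFunction_rat)
    {W : WeierstrassCurve ℚ} [W.IsElliptic] [W.IsGloballyMinimal] (hWeq : W = (⟨1, (-1), 1, (-463430), 97290197⟩ : WeierstrassCurve ℚ)) (hr : W.analyticRank = 0)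
    (hS : ∀ κ : ZpExtension ℚ 3, κ.IsCyclotomic →
      haveI := κ.isGalois_layer_holds (0 + 1)
      haveI := κ.finiteDimensional_layer_holds (0 + 1)
      haveI : NumberField ↥(W.divisionField 3 ⊔ κ.layer (0 + 1)) := NumberField.of_module_finite ℚ _
      ∀ (f : Additive (ClassGroup (𝓞 ↥(W.divisionField 3 ⊔ κ.layer (0 + 1)))) →+ geomTorsion W ((3 : ℕ) : ℤ)),
      (∀ (w : HeightOneSpectrum (𝓞 ↥(W.divisionField 3 ⊔ κ.layer (0 + 1)))) (u : HeightOneSpectrum (𝓞 ℚ)),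
          (((3 : ℕ) : 𝓞 ℚ) ∈ u.asIdeal ∨ (((2 : ℕ) : 𝓞 ℚ) ∈ u.asIdeal ∨ (((5 : ℕ) : 𝓞 ℚ) ∈ u.asIdeal ∨ ((13 : ℕ) : 𝓞 ℚ) ∈ u.asIdeal))) → w.asIdeal.under (𝓞 ℚ) = u.asIdeal →
        f (Additive.ofMul (ClassGroup.mk0 ⟨w.asIdeal, mem_nonZeroDivisors_of_ne_zero w.ne_bot⟩)) = 0) →
      f = 0) :
    MissingUpperBoundAt W 3 := by
  subst hWeq
  haveI : Fact (Nat.Prime 3) := ⟨Nat.prime_three⟩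
  exact WildFineSelmerSupersingularCMAnchor.missingUpperBoundAt_wild_of_conjA hKatoA hGZK hmod _ hr classO6_g228150bz1_3 irr_g228150bz1_3
    (fun κ hκ => conjA_g228150bz1_3_L5 rfl hS κ hκ)

/-! ### `228150hh1` @ `p = 3` — `N = 228150`; Cremona: `r_an = 0`; O6 wild at `3`; image `3Ns`; `ℚ(E[3])` of degree 8 (`h = 8`); `#E(ℚ₃)[3] = 3`;
bad places `2:3;5:1;13:1` (`q:#E(ℚ_q)[3]`); LAYER 1 (kit j314664, GRH): `L₁` of degree 24, `h(L₁) = 72` `[12, 6]`, 12 primes of `L₁` above `3` and the bad primes,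
`3`-rank of `Cl(L₁)/⟨their classes⟩` = 0. Shape (S). First (A)/U₀ record for this row free of `μ`-inputs, Fukuda facts and anchors. -/

/-- `Δ(228150hh1) = ((-78000))³` — a CUBE (kernel, `norm_num`). [cite: Serre1972, §5.3] [cite: Cremona2006, Table 1 (Cremona label 228150hh1)] -/
theorem Δ_cube_g228150hh1 : (⟨1, (-1), 0, (-399567), (-97120659)⟩ : WeierstrassCurve ℚ).Δ = (((-78000) : ℚ)) ^ 3 := by
  norm_num [WeierstrassCurve.Δ, WeierstrassCurve.b₂, WeierstrassCurve.b₄, WeierstrassCurve.b₆, WeierstrassCurve.b₈]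

/-- **(A) AT `(228150hh1, 3)` — NO NAMED FACT.**  Statement (A) of Coates–Sujatha for THIS curve at `p = 3` (the dual fine Selmer group over `ℚ_cyc` is
finitely generated over `ℤ₃`, every cyclotomic `ℤ₃`-extension), by door L5 at layer 1, shape (S): KERNEL `irr_g228150hh1_3`, `Δ_cube_g228150hh1` ; (c3′)₁ by `decide`;
DISPLAYED `hS` (the S-classes generate `Cl(L₁) ⊗ 𝔽₃`, kit j314664 `r3S = 0`); (c3′)₁ KERNEL at `2`, `5`, `13` (`q² % 9 ≠ 1`, `decide`). Per row; nothing booked; (A)/BSD proved for no class.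
[cite: CoatesSujatha2005, §3 Thm. 3.4 and Lemma 3.8] [cite: DeoRaySujatha2023, §3 Thm. 3.8 (c1), (c2), (c3) (arXiv:2202.09937 p. 9)]
[cite: Serre1972, §2.4 Prop. 15, §5.3] [cite: Cremona2006, Table 1 (Cremona label 228150hh1)] -/
theorem conjA_g228150hh1_3_L5
    {W : WeierstrassCurve ℚ} [W.IsElliptic] (hWeq : W = (⟨1, (-1), 0, (-399567), (-97120659)⟩ : WeierstrassCurve ℚ))
    (hS : ∀ κ : ZpExtension ℚ 3, κ.IsCyclotomic →
      haveI := κ.isGalois_layer_holds (0 + 1)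
      haveI := κ.finiteDimensional_layer_holds (0 + 1)
      haveI : NumberField ↥(W.divisionField 3 ⊔ κ.layer (0 + 1)) := NumberField.of_module_finite ℚ _
      ∀ (f : Additive (ClassGroup (𝓞 ↥(W.divisionField 3 ⊔ κ.layer (0 + 1)))) →+ geomTorsion W ((3 : ℕ) : ℤ)),
      (∀ (w : HeightOneSpectrum (𝓞 ↥(W.divisionField 3 ⊔ κ.layer (0 + 1)))) (u : HeightOneSpectrum (𝓞 ℚ)),
          (((3 : ℕ) : 𝓞 ℚ) ∈ u.asIdeal ∨ (((2 : ℕ) : 𝓞 ℚ) ∈ u.asIdeal ∨ (((5 : ℕ) : 𝓞 ℚ) ∈ u.asIdeal ∨ ((13 : ℕ) : 𝓞 ℚ) ∈ u.asIdeal))) → w.asIdeal.under (𝓞 ℚ) = u.asIdeal →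
        f (Additive.ofMul (ClassGroup.mk0 ⟨w.asIdeal, mem_nonZeroDivisors_of_ne_zero w.ne_bot⟩)) = 0) →
      f = 0)
    (κ : ZpExtension ℚ 3) (hκ : κ.IsCyclotomic) :
    ∃ (γ : absoluteGaloisGroup ℚ) (Df : W.FineSelmerDualData κ γ),
      Module.Finite ℤ_[3] (RestrictScalars ℤ_[3] (IwasawaAlgebra 3) Df.X) := by
  subst hWeq
  exact WildFineSelmerLayerOneL5Door.conjA_three_layer_one_of_Δ_eq_cube_of_sClasses _ irr_g228150hh1_3 Δ_cube_g228150hh1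
    (fun u => ((2 : ℕ) : 𝓞 ℚ) ∈ u.asIdeal ∨ (((5 : ℕ) : 𝓞 ℚ) ∈ u.asIdeal ∨ ((13 : ℕ) : 𝓞 ℚ) ∈ u.asIdeal))
    (fun κ' hκ' u hu => by
      rcases hu with h | h | h
      · exact Or.inl (WildFineSelmerLayerOneL5Door.not_decomp_le_layerSubgroup_one hκ' (by norm_num) h (by decide) (by decide))
      · exact Or.inl (WildFineSelmerLayerOneL5Door.not_decomp_le_layerSubgroup_one hκ' (by norm_num) h (by decide) (by decide))
      · exact Or.inl (WildFineSelmerLayerOneL5Door.not_decomp_le_layerSubgroup_one hκ' (by norm_num) h (by decide) (by decide)))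
    hS κ hκ

/-- **RECORD — U₀ `ord₃ #Ш(E) ≤ ord₃ #Ш(E)_an` for `E = 228150hh1` at `p = 3` on the fact-free door L5 (layer 1, shape (S))** (U₀-ns row of K9 items
19189 / 19197): KERNEL `classO6_g228150hh1_3`, `irr_g228150hh1_3`, `Δ_cube_g228150hh1`; DISPLAYED named facts `hKatoA hGZK hmod` ONLY, Cremona's `r_an = 0` (`hr`), and
`hS` (the S-classes generate `Cl(L₁) ⊗ 𝔽₃`, kit j314664 `r3S = 0`); (c3′)₁ KERNEL at `2`, `5`, `13` (`q² % 9 ≠ 1`, `decide`). Per row; nothing booked; BSD is not proved by this.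
[cite: Kato2004Asterisque, Thm. 14.5 (3) (p. 236) and Prop. 14.16 (2)] [cite: CoatesSujatha2005, §3 Thm. 3.4]
[cite: DeoRaySujatha2023, §3 Thm. 3.8] [cite: Cremona2006, Table 1 (Cremona label 228150hh1)] -/
theorem missingUpperBoundAt_g228150hh1_3_L5
    (hKatoA : Kato2004.rankZero_padicValNat_sha_add_padicValNat_tamagawa_le_of_additive_potGood_of_irreducible_of_fineSelmerDual_fg)
    (hGZK : rank_eq_analyticRank_of_analyticRank_le_one) (hmod : hasEntireLFunction_rat)
    {W : WeierstrassCurve ℚ} [W.IsElliptic] [W.IsGloballyMinimal] (hWeq : W = (⟨1, (-1), 0, (-399567), (-97120659)⟩ : WeierstrassCurve ℚ)) (hr : W.analyticRank = 0)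
    (hS : ∀ κ : ZpExtension ℚ 3, κ.IsCyclotomic →
      haveI := κ.isGalois_layer_holds (0 + 1)
      haveI := κ.finiteDimensional_layer_holds (0 + 1)
      haveI : NumberField ↥(W.divisionField 3 ⊔ κ.layer (0 + 1)) := NumberField.of_module_finite ℚ _
      ∀ (f : Additive (ClassGroup (𝓞 ↥(W.divisionField 3 ⊔ κ.layer (0 + 1)))) →+ geomTorsion W ((3 : ℕ) : ℤ)),
      (∀ (w : HeightOneSpectrum (𝓞 ↥(W.divisionField 3 ⊔ κ.layer (0 + 1)))) (u : HeightOneSpectrum (𝓞 ℚ)),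
          (((3 : ℕ) : 𝓞 ℚ) ∈ u.asIdeal ∨ (((2 : ℕ) : 𝓞 ℚ) ∈ u.asIdeal ∨ (((5 : ℕ) : 𝓞 ℚ) ∈ u.asIdeal ∨ ((13 : ℕ) : 𝓞 ℚ) ∈ u.asIdeal))) → w.asIdeal.under (𝓞 ℚ) = u.asIdeal →
        f (Additive.ofMul (ClassGroup.mk0 ⟨w.asIdeal, mem_nonZeroDivisors_of_ne_zero w.ne_bot⟩)) = 0) →
      f = 0) :
    MissingUpperBoundAt W 3 := by
  subst hWeq
  haveI : Fact (Nat.Prime 3) := ⟨Nat.prime_three⟩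
  exact WildFineSelmerSupersingularCMAnchor.missingUpperBoundAt_wild_of_conjA hKatoA hGZK hmod _ hr classO6_g228150hh1_3 irr_g228150hh1_3
    (fun κ hκ => conjA_g228150hh1_3_L5 rfl hS κ hκ)

/-! ### `228150hw1` @ `p = 3` — `N = 228150`; Cremona: `r_an = 0`; O6 wild at `3`; image `3Ns`; `ℚ(E[3])` of degree 8 (`h = 8`); `#E(ℚ₃)[3] = 3`;
bad places `2:3;5:1;13:1` (`q:#E(ℚ_q)[3]`); LAYER 1 (kit j314664, GRH): `L₁` of degree 24, `h(L₁) = 72` `[12, 6]`, 12 primes of `L₁` above `3` and the bad primes,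
`3`-rank of `Cl(L₁)/⟨their classes⟩` = 0. Shape (S). First (A)/U₀ record for this row free of `μ`-inputs, Fukuda facts and anchors. -/

/-- `Δ(228150hw1) = ((-329550))³` — a CUBE (kernel, `norm_num`). [cite: Serre1972, §5.3] [cite: Cremona2006, Table 1 (Cremona label 228150hw1)] -/
theorem Δ_cube_g228150hw1 : (⟨1, (-1), 0, (-51492), 10165416⟩ : WeierstrassCurve ℚ).Δ = (((-329550) : ℚ)) ^ 3 := by
  norm_num [WeierstrassCurve.Δ, WeierstrassCurve.b₂, WeierstrassCurve.b₄, WeierstrassCurve.b₆, WeierstrassCurve.b₈]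

/-- **(A) AT `(228150hw1, 3)` — NO NAMED FACT.**  Statement (A) of Coates–Sujatha for THIS curve at `p = 3` (the dual fine Selmer group over `ℚ_cyc` is
finitely generated over `ℤ₃`, every cyclotomic `ℤ₃`-extension), by door L5 at layer 1, shape (S): KERNEL `irr_g228150hw1_3`, `Δ_cube_g228150hw1` ; (c3′)₁ by `decide`;
DISPLAYED `hS` (the S-classes generate `Cl(L₁) ⊗ 𝔽₃`, kit j314664 `r3S = 0`); (c3′)₁ KERNEL at `2`, `5`, `13` (`q² % 9 ≠ 1`, `decide`). Per row; nothing booked; (A)/BSD proved for no class.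
[cite: CoatesSujatha2005, §3 Thm. 3.4 and Lemma 3.8] [cite: DeoRaySujatha2023, §3 Thm. 3.8 (c1), (c2), (c3) (arXiv:2202.09937 p. 9)]
[cite: Serre1972, §2.4 Prop. 15, §5.3] [cite: Cremona2006, Table 1 (Cremona label 228150hw1)] -/
theorem conjA_g228150hw1_3_L5
    {W : WeierstrassCurve ℚ} [W.IsElliptic] (hWeq : W = (⟨1, (-1), 0, (-51492), 10165416⟩ : WeierstrassCurve ℚ))
    (hS : ∀ κ : ZpExtension ℚ 3, κ.IsCyclotomic →
      haveI := κ.isGalois_layer_holds (0 + 1)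
      haveI := κ.finiteDimensional_layer_holds (0 + 1)
      haveI : NumberField ↥(W.divisionField 3 ⊔ κ.layer (0 + 1)) := NumberField.of_module_finite ℚ _
      ∀ (f : Additive (ClassGroup (𝓞 ↥(W.divisionField 3 ⊔ κ.layer (0 + 1)))) →+ geomTorsion W ((3 : ℕ) : ℤ)),
      (∀ (w : HeightOneSpectrum (𝓞 ↥(W.divisionField 3 ⊔ κ.layer (0 + 1)))) (u : HeightOneSpectrum (𝓞 ℚ)),
          (((3 : ℕ) : 𝓞 ℚ) ∈ u.asIdeal ∨ (((2 : ℕ) : 𝓞 ℚ) ∈ u.asIdeal ∨ (((5 : ℕ) : 𝓞 ℚ) ∈ u.asIdeal ∨ ((13 : ℕ) : 𝓞 ℚ) ∈ u.asIdeal))) → w.asIdeal.under (𝓞 ℚ) = u.asIdeal →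
        f (Additive.ofMul (ClassGroup.mk0 ⟨w.asIdeal, mem_nonZeroDivisors_of_ne_zero w.ne_bot⟩)) = 0) →
      f = 0)
    (κ : ZpExtension ℚ 3) (hκ : κ.IsCyclotomic) :
    ∃ (γ : absoluteGaloisGroup ℚ) (Df : W.FineSelmerDualData κ γ),
      Module.Finite ℤ_[3] (RestrictScalars ℤ_[3] (IwasawaAlgebra 3) Df.X) := by
  subst hWeq
  exact WildFineSelmerLayerOneL5Door.conjA_three_layer_one_of_Δ_eq_cube_of_sClasses _ irr_g228150hw1_3 Δ_cube_g228150hw1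
    (fun u => ((2 : ℕ) : 𝓞 ℚ) ∈ u.asIdeal ∨ (((5 : ℕ) : 𝓞 ℚ) ∈ u.asIdeal ∨ ((13 : ℕ) : 𝓞 ℚ) ∈ u.asIdeal))
    (fun κ' hκ' u hu => by
      rcases hu with h | h | h
      · exact Or.inl (WildFineSelmerLayerOneL5Door.not_decomp_le_layerSubgroup_one hκ' (by norm_num) h (by decide) (by decide))
      · exact Or.inl (WildFineSelmerLayerOneL5Door.not_decomp_le_layerSubgroup_one hκ' (by norm_num) h (by decide) (by decide))
      · exact Or.inl (WildFineSelmerLayerOneL5Door.not_decomp_le_layerSubgroup_one hκ' (by norm_num) h (by decide) (by decide)))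
    hS κ hκ

/-- **RECORD — U₀ `ord₃ #Ш(E) ≤ ord₃ #Ш(E)_an` for `E = 228150hw1` at `p = 3` on the fact-free door L5 (layer 1, shape (S))** (U₀-ns row of K9 items
19189 / 19197): KERNEL `classO6_g228150hw1_3`, `irr_g228150hw1_3`, `Δ_cube_g228150hw1`; DISPLAYED named facts `hKatoA hGZK hmod` ONLY, Cremona's `r_an = 0` (`hr`), and
`hS` (the S-classes generate `Cl(L₁) ⊗ 𝔽₃`, kit j314664 `r3S = 0`); (c3′)₁ KERNEL at `2`, `5`, `13` (`q² % 9 ≠ 1`, `decide`). Per row; nothing booked; BSD is not proved by this.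
[cite: Kato2004Asterisque, Thm. 14.5 (3) (p. 236) and Prop. 14.16 (2)] [cite: CoatesSujatha2005, §3 Thm. 3.4]
[cite: DeoRaySujatha2023, §3 Thm. 3.8] [cite: Cremona2006, Table 1 (Cremona label 228150hw1)] -/
theorem missingUpperBoundAt_g228150hw1_3_L5
    (hKatoA : Kato2004.rankZero_padicValNat_sha_add_padicValNat_tamagawa_le_of_additive_potGood_of_irreducible_of_fineSelmerDual_fg)
    (hGZK : rank_eq_analyticRank_of_analyticRank_le_one) (hmod : hasEntireLFunction_rat)
    {W : WeierstrassCurve ℚ} [W.IsElliptic] [W.IsGloballyMinimal] (hWeq : W = (⟨1, (-1), 0, (-51492), 10165416⟩ : WeierstrassCurve ℚ)) (hr : W.analyticRank = 0)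
    (hS : ∀ κ : ZpExtension ℚ 3, κ.IsCyclotomic →
      haveI := κ.isGalois_layer_holds (0 + 1)
      haveI := κ.finiteDimensional_layer_holds (0 + 1)
      haveI : NumberField ↥(W.divisionField 3 ⊔ κ.layer (0 + 1)) := NumberField.of_module_finite ℚ _
      ∀ (f : Additive (ClassGroup (𝓞 ↥(W.divisionField 3 ⊔ κ.layer (0 + 1)))) →+ geomTorsion W ((3 : ℕ) : ℤ)),
      (∀ (w : HeightOneSpectrum (𝓞 ↥(W.divisionField 3 ⊔ κ.layer (0 + 1)))) (u : HeightOneSpectrum (𝓞 ℚ)),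
          (((3 : ℕ) : 𝓞 ℚ) ∈ u.asIdeal ∨ (((2 : ℕ) : 𝓞 ℚ) ∈ u.asIdeal ∨ (((5 : ℕ) : 𝓞 ℚ) ∈ u.asIdeal ∨ ((13 : ℕ) : 𝓞 ℚ) ∈ u.asIdeal))) → w.asIdeal.under (𝓞 ℚ) = u.asIdeal →
        f (Additive.ofMul (ClassGroup.mk0 ⟨w.asIdeal, mem_nonZeroDivisors_of_ne_zero w.ne_bot⟩)) = 0) →
      f = 0) :
    MissingUpperBoundAt W 3 := by
  subst hWeq
  haveI : Fact (Nat.Prime 3) := ⟨Nat.prime_three⟩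
  exact WildFineSelmerSupersingularCMAnchor.missingUpperBoundAt_wild_of_conjA hKatoA hGZK hmod _ hr classO6_g228150hw1_3 irr_g228150hw1_3
    (fun κ hκ => conjA_g228150hw1_3_L5 rfl hS κ hκ)

/-! ### `228150s1` @ `p = 3` — `N = 228150`; Cremona: `r_an = 0`; O6 wild at `3`; image `3Ns`; `ℚ(E[3])` of degree 8 (`h = 8`); `#E(ℚ₃)[3] = 3`;
bad places `2:3;5:1;13:1` (`q:#E(ℚ_q)[3]`); LAYER 1 (kit j314664, GRH): `L₁` of degree 24, `h(L₁) = 72` `[12, 6]`, 12 primes of `L₁` above `3` and the bad primes,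
`3`-rank of `Cl(L₁)/⟨their classes⟩` = 0. Shape (S). First (A)/U₀ record for this row free of `μ`-inputs, Fukuda facts and anchors. -/

/-- `Δ(228150s1) = (8238750)³` — a CUBE (kernel, `norm_num`). [cite: Serre1972, §5.3] [cite: Cremona2006, Table 1 (Cremona label 228150s1)] -/
theorem Δ_cube_g228150s1 : (⟨1, (-1), 1, (-24685355), 47199542147⟩ : WeierstrassCurve ℚ).Δ = ((8238750 : ℚ)) ^ 3 := by
  norm_num [WeierstrassCurve.Δ, WeierstrassCurve.b₂, WeierstrassCurve.b₄, WeierstrassCurve.b₆, WeierstrassCurve.b₈]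

/-- **(A) AT `(228150s1, 3)` — NO NAMED FACT.**  Statement (A) of Coates–Sujatha for THIS curve at `p = 3` (the dual fine Selmer group over `ℚ_cyc` is
finitely generated over `ℤ₃`, every cyclotomic `ℤ₃`-extension), by door L5 at layer 1, shape (S): KERNEL `irr_g228150s1_3`, `Δ_cube_g228150s1` ; (c3′)₁ by `decide`;
DISPLAYED `hS` (the S-classes generate `Cl(L₁) ⊗ 𝔽₃`, kit j314664 `r3S = 0`); (c3′)₁ KERNEL at `2`, `5`, `13` (`q² % 9 ≠ 1`, `decide`). Per row; nothing booked; (A)/BSD proved for no class.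
[cite: CoatesSujatha2005, §3 Thm. 3.4 and Lemma 3.8] [cite: DeoRaySujatha2023, §3 Thm. 3.8 (c1), (c2), (c3) (arXiv:2202.09937 p. 9)]
[cite: Serre1972, §2.4 Prop. 15, §5.3] [cite: Cremona2006, Table 1 (Cremona label 228150s1)] -/
theorem conjA_g228150s1_3_L5
    {W : WeierstrassCurve ℚ} [W.IsElliptic] (hWeq : W = (⟨1, (-1), 1, (-24685355), 47199542147⟩ : WeierstrassCurve ℚ))
    (hS : ∀ κ : ZpExtension ℚ 3, κ.IsCyclotomic →
      haveI := κ.isGalois_layer_holds (0 + 1)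
      haveI := κ.finiteDimensional_layer_holds (0 + 1)
      haveI : NumberField ↥(W.divisionField 3 ⊔ κ.layer (0 + 1)) := NumberField.of_module_finite ℚ _
      ∀ (f : Additive (ClassGroup (𝓞 ↥(W.divisionField 3 ⊔ κ.layer (0 + 1)))) →+ geomTorsion W ((3 : ℕ) : ℤ)),
      (∀ (w : HeightOneSpectrum (𝓞 ↥(W.divisionField 3 ⊔ κ.layer (0 + 1)))) (u : HeightOneSpectrum (𝓞 ℚ)),
          (((3 : ℕ) : 𝓞 ℚ) ∈ u.asIdeal ∨ (((2 : ℕ) : 𝓞 ℚ) ∈ u.asIdeal ∨ (((5 : ℕ) : 𝓞 ℚ) ∈ u.asIdeal ∨ ((13 : ℕ) : 𝓞 ℚ) ∈ u.asIdeal))) → w.asIdeal.under (𝓞 ℚ) = u.asIdeal →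
        f (Additive.ofMul (ClassGroup.mk0 ⟨w.asIdeal, mem_nonZeroDivisors_of_ne_zero w.ne_bot⟩)) = 0) →
      f = 0)
    (κ : ZpExtension ℚ 3) (hκ : κ.IsCyclotomic) :
    ∃ (γ : absoluteGaloisGroup ℚ) (Df : W.FineSelmerDualData κ γ),
      Module.Finite ℤ_[3] (RestrictScalars ℤ_[3] (IwasawaAlgebra 3) Df.X) := by
  subst hWeq
  exact WildFineSelmerLayerOneL5Door.conjA_three_layer_one_of_Δ_eq_cube_of_sClasses _ irr_g228150s1_3 Δ_cube_g228150s1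
    (fun u => ((2 : ℕ) : 𝓞 ℚ) ∈ u.asIdeal ∨ (((5 : ℕ) : 𝓞 ℚ) ∈ u.asIdeal ∨ ((13 : ℕ) : 𝓞 ℚ) ∈ u.asIdeal))
    (fun κ' hκ' u hu => by
      rcases hu with h | h | h
      · exact Or.inl (WildFineSelmerLayerOneL5Door.not_decomp_le_layerSubgroup_one hκ' (by norm_num) h (by decide) (by decide))
      · exact Or.inl (WildFineSelmerLayerOneL5Door.not_decomp_le_layerSubgroup_one hκ' (by norm_num) h (by decide) (by decide))
      · exact Or.inl (WildFineSelmerLayerOneL5Door.not_decomp_le_layerSubgroup_one hκ' (by norm_num) h (by decide) (by decide)))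
    hS κ hκ

/-- **RECORD — U₀ `ord₃ #Ш(E) ≤ ord₃ #Ш(E)_an` for `E = 228150s1` at `p = 3` on the fact-free door L5 (layer 1, shape (S))** (U₀-ns row of K9 items
19189 / 19197): KERNEL `classO6_g228150s1_3`, `irr_g228150s1_3`, `Δ_cube_g228150s1`; DISPLAYED named facts `hKatoA hGZK hmod` ONLY, Cremona's `r_an = 0` (`hr`), and
`hS` (the S-classes generate `Cl(L₁) ⊗ 𝔽₃`, kit j314664 `r3S = 0`); (c3′)₁ KERNEL at `2`, `5`, `13` (`q² % 9 ≠ 1`, `decide`). Per row; nothing booked; BSD is not proved by this.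
[cite: Kato2004Asterisque, Thm. 14.5 (3) (p. 236) and Prop. 14.16 (2)] [cite: CoatesSujatha2005, §3 Thm. 3.4]
[cite: DeoRaySujatha2023, §3 Thm. 3.8] [cite: Cremona2006, Table 1 (Cremona label 228150s1)] -/
theorem missingUpperBoundAt_g228150s1_3_L5
    (hKatoA : Kato2004.rankZero_padicValNat_sha_add_padicValNat_tamagawa_le_of_additive_potGood_of_irreducible_of_fineSelmerDual_fg)
    (hGZK : rank_eq_analyticRank_of_analyticRank_le_one) (hmod : hasEntireLFunction_rat)
    {W : WeierstrassCurve ℚ} [W.IsElliptic] [W.IsGloballyMinimal] (hWeq : W = (⟨1, (-1), 1, (-24685355), 47199542147⟩ : WeierstrassCurve ℚ)) (hr : W.analyticRank = 0)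
    (hS : ∀ κ : ZpExtension ℚ 3, κ.IsCyclotomic →
      haveI := κ.isGalois_layer_holds (0 + 1)
      haveI := κ.finiteDimensional_layer_holds (0 + 1)
      haveI : NumberField ↥(W.divisionField 3 ⊔ κ.layer (0 + 1)) := NumberField.of_module_finite ℚ _
      ∀ (f : Additive (ClassGroup (𝓞 ↥(W.divisionField 3 ⊔ κ.layer (0 + 1)))) →+ geomTorsion W ((3 : ℕ) : ℤ)),
      (∀ (w : HeightOneSpectrum (𝓞 ↥(W.divisionField 3 ⊔ κ.layer (0 + 1)))) (u : HeightOneSpectrum (𝓞 ℚ)),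
          (((3 : ℕ) : 𝓞 ℚ) ∈ u.asIdeal ∨ (((2 : ℕ) : 𝓞 ℚ) ∈ u.asIdeal ∨ (((5 : ℕ) : 𝓞 ℚ) ∈ u.asIdeal ∨ ((13 : ℕ) : 𝓞 ℚ) ∈ u.asIdeal))) → w.asIdeal.under (𝓞 ℚ) = u.asIdeal →
        f (Additive.ofMul (ClassGroup.mk0 ⟨w.asIdeal, mem_nonZeroDivisors_of_ne_zero w.ne_bot⟩)) = 0) →
      f = 0) :
    MissingUpperBoundAt W 3 := by
  subst hWeq
  haveI : Fact (Nat.Prime 3) := ⟨Nat.prime_three⟩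
  exact WildFineSelmerSupersingularCMAnchor.missingUpperBoundAt_wild_of_conjA hKatoA hGZK hmod _ hr classO6_g228150s1_3 irr_g228150s1_3
    (fun κ hκ => conjA_g228150s1_3_L5 rfl hS κ hκ)

end Summit.BirchSwinnertonDyer.BirchSwinnertonDyer.Theorems.WildFineSelmerLayerOneL5Records

end
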